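import Summits.CriticalPhenomena.PercolationContinuityZ3.Theorems.Transplant.CayleyCylinderWalks
import HarnessLib

/-!
# Cylinders of a Cayley-graph skeleton, II: columns, the frame walk, and the cycle kit of a small-cylinder edge

builds on p205010 (kernel theorem, internal audit signed; external expert review pending) — nothing in this file uses p205010.
Lane `prim-bschramm`, seat `prim-bschramm-p4` gen 10 (PART C3, tier 2′ of `P4-GENERAL.md`).  Helper file
(`--supports stmt-CriticalPhenomena-4575 --as helper`).  Sequel of `CayleyCylinderWalks`.

In the big cylinder `V = {‖φ‖_∞ ≤ ℓ+1}` of `Cay(Γ; S)` (graph `H = G.induce V`) we build for every edge `{x, y}` with both ends in the small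
cylinder `‖φ‖_∞ ≤ ℓ` (and `y ≠ x s₀⁻¹`) a `SubLoc.CycleKit`: `A` = the `s₀⁻¹`-column of `x` down to the floor `φ₀ = −(ℓ+1)`, `B` = the
`s₀`-column of `y` up to the ceiling (reversed), `M` = a simple path on the FRAME `‖φ‖_∞ = ℓ+1` from the floor point to the ceiling point
(floor → corner by `s₁`, side by `s₀`, ceiling by `s₁⁻¹`, then a kernel word; `Walk.bypass`).  Frame edges are enhancement edges (they leave
the small cylinder); columns are `s₀`-strings, so the column classes `g ↦ g s₀^{−φ₀(g)}` are constant on `A` and on `B`; the whole kit lies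
in the ball of radius `CylData.R` about `x`.
-/

noncomputable section

namespace Summit.CriticalPhenomena.PercolationContinuityZ3.Theorems.Transplant

namespace CayCyl

open SimpleGraph Walk Literature.Probability.LatticeModels SubLoc
open Literature.Barriers.CriticalPhenomena (graphBall graphBall_mono mem_graphBall_self graphBall_finite)
open scoped Classical

variable {Γ : Type} [Group Γ] {S : Finset Γ}

/-! ## §1 Induced walks: three bookkeeping lemmas -/

/-- Membership in the support of an induced walk. [folklore] -/
theorem mem_support_induce_iff {W : Type} {G : SimpleGraph W} {s : Set W} {u v : W} (w : G.Walk u v) (hw : ∀ z ∈ w.support, z ∈ s)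
    (z : s) : z ∈ (w.induce s hw).support ↔ z.1 ∈ w.support := by
  simp [Walk.support_induce]

/-- Membership in the support of a reversed walk. [folklore] -/
theorem mem_support_reverse_iff {W : Type} {G : SimpleGraph W} {u v : W} (p : G.Walk u v) (z : W) :
    z ∈ p.reverse.support ↔ z ∈ p.support := by
  rw [Walk.support_reverse, List.mem_reverse]

/-- The length of an induced walk. [folklore] -/
theorem length_induce {W : Type} {G : SimpleGraph W} {s : Set W} {u v : W} (w : G.Walk u v) (hw : ∀ z ∈ w.support, z ∈ s) :
    (w.induce s hw).length = w.length := by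
  have h := Walk.length_map (Embedding.induce s).toHom (w.induce s hw)
  rw [Walk.map_induce] at h
  exact h.symm

/-- An induced walk is a path iff the walk is. [folklore] -/
theorem isPath_induce_iff {W : Type} {G : SimpleGraph W} {s : Set W} {u v : W} (w : G.Walk u v) (hw : ∀ z ∈ w.support, z ∈ s) :
    (w.induce s hw).IsPath ↔ w.IsPath := by
  have h := Walk.isPath_map_iff_of_injective (f := (Embedding.induce s : G.induce s ↪g G).toHom) (p := w.induce s hw)
    (Embedding.induce s : G.induce s ↪g G).injective
  rw [Walk.map_induce] at h
  exact h.symm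

namespace CylData

variable (D : CylData Γ S)

/-! ## §2 Cylinders and coordinates -/

/-- The cylinder `{‖φ‖_∞ ≤ L}` as a vertex set. [cite: KozmaNitzan2024, §4 p. 15 (boxes)] -/
def V (L : ℕ) : Set Γ := {g | D.φ g ∈ box 2 L}

/-- Membership in a cylinder, coordinatewise. [folklore] -/
theorem memV {L : ℕ} {g : Γ} : g ∈ D.V L ↔ |D.φ g 0| ≤ L ∧ |D.φ g 1| ≤ L := by
  simp only [V, Set.mem_setOf_eq, mem_box, Fin.forall_fin_two, abs_le]

/-- Membership of `φ g` in a box, coordinatewise. [folklore] -/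
theorem mem_box_iff {L : ℕ} {g : Γ} : D.φ g ∈ box 2 L ↔ |D.φ g 0| ≤ L ∧ |D.φ g 1| ≤ L := by
  simp only [mem_box, Fin.forall_fin_two, abs_le]

/-- The cylinder graph `H = Cay(Γ;S)[V_L]`. [cite: KozmaNitzan2024, §4 p. 15 (boxes)] -/
abbrev cylG (L : ℕ) : SimpleGraph (D.V L) := (mulCayley (S : Set Γ)).induce (D.V L)

/-- Coordinates along the `s₀⁻¹`-column. [folklore] -/
theorem φ_s₀inv_pow (g : Γ) (i : ℕ) : D.φ (g * D.s₀⁻¹ ^ i) 0 = D.φ g 0 - i ∧ D.φ (g * D.s₀⁻¹ ^ i) 1 = D.φ g 1 := by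
  have h : D.φ (g * D.s₀⁻¹ ^ i) = D.φ g + Pi.single 0 (-(i : ℤ)) := by
    rw [inv_pow, ← zpow_natCast, ← zpow_neg, D.φ_mul_s₀_zpow]
  constructor
  · rw [h]; simp [sub_eq_add_neg]
  · rw [h]; simp

/-- Coordinates along the `s₀`-column. [folklore] -/
theorem φ_s₀_pow (g : Γ) (i : ℕ) : D.φ (g * D.s₀ ^ i) 0 = D.φ g 0 + i ∧ D.φ (g * D.s₀ ^ i) 1 = D.φ g 1 := by
  have h : D.φ (g * D.s₀ ^ i) = D.φ g + Pi.single 0 (i : ℤ) := by rw [← zpow_natCast, D.φ_mul_s₀_zpow]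
  constructor
  · rw [h]; simp
  · rw [h]; simp

/-- Coordinates along the `s₁`-row. [folklore] -/
theorem φ_s₁_pow (g : Γ) (i : ℕ) : D.φ (g * D.s₁ ^ i) 0 = D.φ g 0 ∧ D.φ (g * D.s₁ ^ i) 1 = D.φ g 1 + i := by
  have h : D.φ (g * D.s₁ ^ i) = D.φ g + Pi.single 1 (i : ℤ) := by rw [← zpow_natCast, D.φ_mul_s₁_zpow]
  constructor
  · rw [h]; simp
  · rw [h]; simp

/-- Coordinates along the `s₁⁻¹`-row. [folklore] -/
theorem φ_s₁inv_pow (g : Γ) (i : ℕ) : D.φ (g * D.s₁⁻¹ ^ i) 0 = D.φ g 0 ∧ D.φ (g * D.s₁⁻¹ ^ i) 1 = D.φ g 1 - i := by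
  have h : D.φ (g * D.s₁⁻¹ ^ i) = D.φ g + Pi.single 1 (-(i : ℤ)) := by
    rw [inv_pow, ← zpow_natCast, ← zpow_neg, D.φ_mul_s₁_zpow]
  constructor
  · rw [h]; simp
  · rw [h]; simp [sub_eq_add_neg]

/-! ## §3 The columns and the frame of an edge of the small cylinder -/

section Kit

variable {ℓ : ℕ} (x y : D.V (ℓ + 1))

/-- Depth of `x` above the floor: `ℓ + 1 + φ₀ x`. [folklore] -/
def nA : ℕ := ((ℓ : ℤ) + 1 + D.φ x.1 0).toNat

/-- Height of the ceiling above `y`: `ℓ + 1 − φ₀ y`. [folklore] -/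
def nB : ℕ := ((ℓ : ℤ) + 1 - D.φ y.1 0).toNat

/-- Steps from `φ₁ x` to the right wall. [folklore] -/
def m₁ : ℕ := ((ℓ : ℤ) + 1 - D.φ x.1 1).toNat

/-- Steps from the right wall back to `φ₁ y`. [folklore] -/
def m₂ : ℕ := ((ℓ : ℤ) + 1 - D.φ y.1 1).toNat

/-- `nA` as an integer. [folklore] -/
theorem nA_eq : (D.nA x : ℤ) = ℓ + 1 + D.φ x.1 0 := by
  have h := (D.memV.1 x.2).1; rw [abs_le] at h; unfold nA; omega

/-- `nB` as an integer. [folklore] -/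
theorem nB_eq : (D.nB y : ℤ) = ℓ + 1 - D.φ y.1 0 := by
  have h := (D.memV.1 y.2).1; rw [abs_le] at h; unfold nB; omega

/-- `m₁` as an integer. [folklore] -/
theorem m₁_eq : (D.m₁ x : ℤ) = ℓ + 1 - D.φ x.1 1 := by
  have h := (D.memV.1 x.2).2; rw [abs_le] at h; unfold m₁; omega

/-- `m₂` as an integer. [folklore] -/
theorem m₂_eq : (D.m₂ y : ℤ) = ℓ + 1 - D.φ y.1 1 := by
  have h := (D.memV.1 y.2).2; rw [abs_le] at h; unfold m₂; omega

/-- The floor point `p = x s₀^{−nA}`. [folklore] -/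
abbrev pt : Γ := x.1 * D.s₀⁻¹ ^ D.nA x

/-- The ceiling point `q = y s₀^{nB}`. [folklore] -/
abbrev qt : Γ := y.1 * D.s₀ ^ D.nB y

/-- Coordinates of the floor point. [folklore] -/
theorem φ_pt : D.φ (D.pt x) 0 = -(ℓ + 1 : ℤ) ∧ D.φ (D.pt x) 1 = D.φ x.1 1 := by
  have h := D.φ_s₀inv_pow x.1 (D.nA x); have e := D.nA_eq x; constructor <;> linarith [h.1, h.2]

/-- Coordinates of the ceiling point. [folklore] -/
theorem φ_qt : D.φ (D.qt y) 0 = (ℓ + 1 : ℤ) ∧ D.φ (D.qt y) 1 = D.φ y.1 1 := by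
  have h := D.φ_s₀_pow y.1 (D.nB y); have e := D.nB_eq y; constructor <;> linarith [h.1, h.2]

/-- Coordinates of the first corner `c₁ = p s₁^{m₁}`. [folklore] -/
theorem φ_c₁ : D.φ (D.pt x * D.s₁ ^ D.m₁ x) 0 = -(ℓ + 1 : ℤ) ∧ D.φ (D.pt x * D.s₁ ^ D.m₁ x) 1 = (ℓ + 1 : ℤ) := by
  have h := D.φ_s₁_pow (D.pt x) (D.m₁ x); have e := D.m₁_eq x; have hp := D.φ_pt x
  constructor <;> linarith [h.1, h.2, hp.1, hp.2]

/-- Coordinates of the second corner `c₂ = c₁ s₀^{2ℓ+2}`. [folklore] -/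
theorem φ_c₂ : D.φ (D.pt x * D.s₁ ^ D.m₁ x * D.s₀ ^ (2 * (ℓ + 1))) 0 = (ℓ + 1 : ℤ) ∧
    D.φ (D.pt x * D.s₁ ^ D.m₁ x * D.s₀ ^ (2 * (ℓ + 1))) 1 = (ℓ + 1 : ℤ) := by
  have h := D.φ_s₀_pow (D.pt x * D.s₁ ^ D.m₁ x) (2 * (ℓ + 1)); have hc := D.φ_c₁ x
  constructor
  · rw [h.1, hc.1]; push_cast; ring
  · rw [h.2, hc.2]

/-- The third point `c₃ = c₂ s₁^{−m₂}` on the ceiling at `(ℓ+1, φ₁ y)`. [folklore] -/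
abbrev c₃ : Γ := D.pt x * D.s₁ ^ D.m₁ x * D.s₀ ^ (2 * (ℓ + 1)) * D.s₁⁻¹ ^ D.m₂ y

/-- Coordinates of the third point. [folklore] -/
theorem φ_c₃ : D.φ (D.c₃ x y) 0 = (ℓ + 1 : ℤ) ∧ D.φ (D.c₃ x y) 1 = D.φ y.1 1 := by
  have h := D.φ_s₁inv_pow (D.pt x * D.s₁ ^ D.m₁ x * D.s₀ ^ (2 * (ℓ + 1))) (D.m₂ y); have e := D.m₂_eq y; have hc := D.φ_c₂ x
  constructor <;> linarith [h.1, h.2, hc.1, hc.2]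

/-- The kernel element closing the frame: `k = c₃⁻¹ q`. [folklore] -/
def kel : Γ := (D.c₃ x y)⁻¹ * D.qt y

/-- `k ∈ ker φ`. [folklore] -/
theorem φ_kel : D.φ (D.kel x y) = 0 := by
  have h1 := D.φ_c₃ x y; have h2 := D.φ_qt y
  rw [kel, D.map_mul, D.φ_inv]
  funext i; fin_cases i
  · show -D.φ (D.c₃ x y) 0 + D.φ (D.qt y) 0 = 0; rw [h1.1, h2.1]; ring
  · show -D.φ (D.c₃ x y) 1 + D.φ (D.qt y) 1 = 0; rw [h1.2, h2.2]; ring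

/-- The kernel segment of the frame: the chosen word for `k`, translated to start at `c₃` and end at `q`. [folklore] -/
def seg₄ : (mulCayley (S : Set Γ)).Walk (D.c₃ x y) (D.qt y) :=
  (lmul S (D.c₃ x y) (D.kerWalk (D.kel x y) (D.φ_kel x y))).copy (mul_one _) (mul_inv_cancel_left _ _)

/-- The length of the kernel segment. [folklore] -/
theorem length_seg₄ : (D.seg₄ x y).length = D.kerWalkLen (D.kel x y) := by
  simp only [seg₄, Walk.length_copy, length_lmul, D.length_kerWalk]

/-- Vertices of the kernel segment sit at `(ℓ+1, φ₁ y)`. [folklore] -/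
theorem φ_seg₄ {v : Γ} (hv : v ∈ (D.seg₄ x y).support) : D.φ v 0 = (ℓ + 1 : ℤ) ∧ D.φ v 1 = D.φ y.1 1 := by
  rw [seg₄, support_copy] at hv
  obtain ⟨v', hv', rfl⟩ := mem_support_lmul.1 hv
  have h0 := D.kerWalk_level _ (D.φ_kel x y) v' hv'
  have hc := D.φ_c₃ x y
  constructor
  · rw [D.map_mul, Pi.add_apply, h0, hc.1]; simp
  · rw [D.map_mul, Pi.add_apply, h0, hc.2]; simp

/-- **The frame walk** `p → c₁ → c₂ → c₃ → q` in `Cay(Γ; S)`. [folklore] -/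
def frame : (mulCayley (S : Set Γ)).Walk (D.pt x) (D.qt y) :=
  (powWalk S D.adj_s₁ (D.pt x) (D.m₁ x)).append <|
    (powWalk S D.adj_s₀ (D.pt x * D.s₁ ^ D.m₁ x) (2 * (ℓ + 1))).append <|
      (powWalk S D.adj_s₁_inv (D.pt x * D.s₁ ^ D.m₁ x * D.s₀ ^ (2 * (ℓ + 1))) (D.m₂ y)).append (D.seg₄ x y)

/-- **Every frame vertex lies in the big cylinder and outside the small one.** [folklore] -/
theorem frame_mem {v : Γ} (hv : v ∈ (D.frame x y).support) : v ∈ D.V (ℓ + 1) ∧ D.φ v ∉ box 2 ℓ := by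
  have hx1 := (D.memV.1 x.2).2; have hy1 := (D.memV.1 y.2).2
  rw [abs_le] at hx1 hy1
  rw [D.memV, D.mem_box_iff, abs_le, abs_le, abs_le, abs_le]
  rw [frame] at hv
  rcases (Walk.mem_support_append_iff _ _).1 hv with hv | hv
  · obtain ⟨i, hi, rfl⟩ := (mem_support_powWalk _).1 hv
    have h := D.φ_s₁_pow (D.pt x) i; have hp := D.φ_pt x; have e := D.m₁_eq x
    have hi' : (i : ℤ) ≤ D.m₁ x := by exact_mod_cast hi
    rw [h.1, h.2, hp.1, hp.2]; omega
  rcases (Walk.mem_support_append_iff _ _).1 hv with hv | hv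
  · obtain ⟨i, hi, rfl⟩ := (mem_support_powWalk _).1 hv
    have h := D.φ_s₀_pow (D.pt x * D.s₁ ^ D.m₁ x) i; have hc := D.φ_c₁ x
    have hi' : (i : ℤ) ≤ 2 * (ℓ + 1) := by exact_mod_cast hi
    rw [h.1, h.2, hc.1, hc.2]; omega
  rcases (Walk.mem_support_append_iff _ _).1 hv with hv | hv
  · obtain ⟨i, hi, rfl⟩ := (mem_support_powWalk _).1 hv
    have h := D.φ_s₁inv_pow (D.pt x * D.s₁ ^ D.m₁ x * D.s₀ ^ (2 * (ℓ + 1))) i; have hc := D.φ_c₂ x; have e := D.m₂_eq y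
    have hi' : (i : ℤ) ≤ D.m₂ y := by exact_mod_cast hi
    rw [h.1, h.2, hc.1, hc.2]; omega
  · have h := D.φ_seg₄ x y hv
    rw [h.1, h.2]; omega

/-- The length of the frame walk. [folklore] -/
theorem length_frame : (D.frame x y).length = D.m₁ x + 2 * (ℓ + 1) + D.m₂ y + D.kerWalkLen (D.kel x y) := by
  rw [frame, Walk.length_append, Walk.length_append, Walk.length_append, length_seg₄, length_powWalk, length_powWalk,
    length_powWalk]
  ring

/-- The column of `x` stays in the big cylinder. [folklore] -/
theorem colA_mem : ∀ z ∈ (powWalk S D.adj_s₀_inv x.1 (D.nA x)).support, z ∈ D.V (ℓ + 1) := by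
  intro z hz
  obtain ⟨i, hi, rfl⟩ := (mem_support_powWalk _).1 hz
  have h := D.φ_s₀inv_pow x.1 i; have hx := D.memV.1 x.2; have e := D.nA_eq x
  have hi' : (i : ℤ) ≤ D.nA x := by exact_mod_cast hi
  rw [abs_le, abs_le] at hx
  rw [D.memV, abs_le, abs_le, h.1, h.2]; omega

/-- The column of `y` stays in the big cylinder. [folklore] -/
theorem colB_mem : ∀ z ∈ (powWalk S D.adj_s₀ y.1 (D.nB y)).support, z ∈ D.V (ℓ + 1) := by
  intro z hz
  obtain ⟨i, hi, rfl⟩ := (mem_support_powWalk _).1 hz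
  have h := D.φ_s₀_pow y.1 i; have hy := D.memV.1 y.2; have e := D.nB_eq y
  have hi' : (i : ℤ) ≤ D.nB y := by exact_mod_cast hi
  rw [abs_le, abs_le] at hy
  rw [D.memV, abs_le, abs_le, h.1, h.2]; omega

/-- `p` as a vertex of `H`. [folklore] -/
abbrev pV : D.V (ℓ + 1) := ⟨D.pt x, D.colA_mem x _ (Walk.end_mem_support _)⟩

/-- `q` as a vertex of `H`. [folklore] -/
abbrev qV : D.V (ℓ + 1) := ⟨D.qt y, D.colB_mem y _ (Walk.end_mem_support _)⟩

/-- **The column of `x` down to the floor**, as a walk of `H`. [folklore] -/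
def colA : (D.cylG (ℓ + 1)).Walk x (D.pV x) := (powWalk S D.adj_s₀_inv x.1 (D.nA x)).induce (D.V (ℓ + 1)) (D.colA_mem x)

/-- **The column of `y` up to the ceiling, reversed**, as a walk of `H`. [folklore] -/
def colB : (D.cylG (ℓ + 1)).Walk (D.qV y) y := ((powWalk S D.adj_s₀ y.1 (D.nB y)).induce (D.V (ℓ + 1)) (D.colB_mem y)).reverse

/-- **The frame as a simple path of `H`.** [folklore] -/
def pathM : (D.cylG (ℓ + 1)).Walk (D.pV x) (D.qV y) := ((D.frame x y).induce (D.V (ℓ + 1)) fun _ hz => (D.frame_mem x y hz).1).bypass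

/-- Vertices of `colA` are `x s₀^{−i}`, `i ≤ nA`. [folklore] -/
theorem mem_colA {z : D.V (ℓ + 1)} (hz : z ∈ (D.colA x).support) : ∃ i, i ≤ D.nA x ∧ z.1 = x.1 * D.s₀⁻¹ ^ i :=
  (mem_support_powWalk _).1 ((mem_support_induce_iff _ (D.colA_mem x) z).1 hz)

/-- Vertices of `colB` are `y s₀^{j}`, `j ≤ nB`. [folklore] -/
theorem mem_colB {z : D.V (ℓ + 1)} (hz : z ∈ (D.colB y).support) : ∃ j, j ≤ D.nB y ∧ z.1 = y.1 * D.s₀ ^ j := by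
  have hz' : z ∈ ((powWalk S D.adj_s₀ y.1 (D.nB y)).induce (D.V (ℓ + 1)) (D.colB_mem y)).support :=
    (mem_support_reverse_iff _ z).1 hz
  exact (mem_support_powWalk _).1 ((mem_support_induce_iff _ (D.colB_mem y) z).1 hz')

/-- Vertices of `pathM` are frame vertices (outside the small cylinder). [folklore] -/
theorem mem_pathM {z : D.V (ℓ + 1)} (hz : z ∈ (D.pathM x y).support) : z.1 ∈ (D.frame x y).support :=
  (mem_support_induce_iff _ _ _).1 (support_bypass_subset_support _ hz)

end Kit

end CylData

end CayCyl

end Summit.CriticalPhenomena.PercolationContinuityZ3.Theorems.Transplant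

end
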